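import Summits.QuantumAdvantage.QuantumAdvantage.Theorems.CubicForrelationNearExactIsExactFourModSixSecondSplitBudget
import Summits.QuantumAdvantage.QuantumAdvantage.Theorems.CubicForrelationNearExactIsExactSixteenSplitC

/-!
# Crux `CubicForrelation.NearExactIsExact` (stmt-QuantumAdvantage-14043) — `n = 6r+4`, TWO-SIDED, second boundary: split configuration (sC)
  is empty (`r ≥ 3`)

Certificate seat `b2b-cforr-cert` (gen 8).  HONEST FRAMING: a theorem uniform in `r` about cubic Boolean pairs on `6r+4` bits (the tree's
`n = 16` file `…SixteenSplitC.lean` in general `r`); one of the three split configurations of `f2_split_trichotomy`; NOT summit progress.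

Configuration (sC): parity `d₀` affine non-constant (support `L`, complement `H`), `A = B' = ∅` (`u ≡ 0 (mod 8)` on `H`), and
`C' := L ∩ {d₁ ≠ d₂} = supp(d₁ ⊕ d₂)` an `(n−4)`-flat inside `L`, budget identity and pointwise equality.  The residual is
`τ = (−1)^{d₁}(1_L − 4·1_{C'})` (`|τ| = 3` on `C'`), `0` on `H`.  `L`-piece: `V_L` periods up to sign (`d₁ ≡ 0` on `H`) ⇒ `Σ|·̂| ≤ N`;
`C'`-piece: `V_{C'} ⊆ V_L` periods up to sign (`D_a d₁` affine, vanishing on `H`, constant on `L`) ⇒ `Σ|·̂| ≤ N`; total `≤ 5N` against the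
pairing `2^{2r+1}N ≥ 128N`.

References: J. Ax (1964) / R. J. McEliece (1972); MacWilliams–Sloane (1977) Ch. 13–15; R. O'Donnell (2014) §3.3.  Everything below is proved
from Mathlib and the tree; axioms are the standard three.
-/

set_option linter.dupNamespace false -- D-0017: single-problem summit ⇒ `QuantumAdvantage.QuantumAdvantage` by design

noncomputable section

namespace Summit.QuantumAdvantage.QuantumAdvantage.Theorems.CubicForrelation.NearExactIsExact

open Finset
open Literature.Computability.QuantumComplexity
open Literature.Computability.QuantumComplexity.BuzetChailloux (bxor zeroVec bxor_bxor_cancel_left bxor_zeroVec zeroVec_bxor bxor_comm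
  bxor_self)
open Literature.Computability.QuantumComplexity.DerivativeWalsh (W)

/-- **Configuration (sC) is empty (`r ≥ 3`).**  For cubic `f, g : 𝔽₂^{(3r+2)+(3r+2)} → 𝔽₂` with `W_g = 2^{2r+2}u`, a non-constant parity
`[u odd]`, the budget identity `2^{8r+5}(1−Φ) = 2^{6r+4}`, the pointwise budget identity of `f2_split_trichotomy`, and digit sets
`A = B' = ∅`, `#C' = N/16`: contradiction.  Uniform in `r`; NOT summit progress. [this work] -/
theorem f2_splitC_false (r : ℕ) (hr : 3 ≤ r) (f g : (Fin ((3 * r + 2) + (3 * r + 2)) → Bool) → Bool) (hf : IsDegLeFun 3 f)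
    (hg : IsDegLeFun 3 g) (u : (Fin ((3 * r + 2) + (3 * r + 2)) → Bool) → ℤ)
    (hu : ∀ x, W (fun y => signOf (g y)) x = (2 : ℝ) ^ (2 * r + 2) * (u x : ℝ))
    (hodd : ∃ x, Odd (u x)) (heven : ∃ x, ¬ Odd (u x))
    (hTeq : (2 : ℝ) ^ (8 * r + 5) * (1 - forrelation f g) = 2 ^ (6 * r + 4))
    (hpt : ∀ x, (u x - 2 ^ r * sZ (f x)) ^ 2 = (if Odd (u x) then 1 else 0) + 4 * (if ¬ Odd (u x) ∧ Odd (u x / 2) then 1 else 0)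
      + 16 * (if ¬ Odd (u x) ∧ ¬ Odd (u x / 2) ∧ Odd (u x / 2 / 2) then 1 else 0)
      + 8 * (if Odd (u x) ∧ ¬ (Odd (u x / 2) ↔ Odd (u x / 2 / 2)) then 1 else 0))
    (hA0 : #(univ.filter fun x : Fin ((3 * r + 2) + (3 * r + 2)) → Bool => ¬ Odd (u x) ∧ Odd (u x / 2)) = 0)
    (hB0 : #(univ.filter fun x : Fin ((3 * r + 2) + (3 * r + 2)) → Bool => ¬ Odd (u x) ∧ ¬ Odd (u x / 2) ∧ Odd (u x / 2 / 2)) = 0)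
    (hCc : #(univ.filter fun x : Fin ((3 * r + 2) + (3 * r + 2)) → Bool =>
      Odd (u x) ∧ ¬ (Odd (u x / 2) ↔ Odd (u x / 2 / 2))) = 2 ^ (6 * r)) : False := by
  classical
  have _hf := hf
  have hd0 : IsDegLeFun 1 (fun x => decide (Odd (u x))) := f2_digitZero r g u hg hu
  have hd1 : IsDegLeFun 2 (fun x => decide (Odd (u x / 2))) := f2_digitOne r g u hg hu
  have hd2 : IsDegLeFun 4 (fun x => decide (Odd (u x / 2 / 2))) := f2_digitTwo r g u hg hu
  have hLc : #(univ.filter fun x : Fin ((3 * r + 2) + (3 * r + 2)) → Bool => Odd (u x)) = 2 ^ (6 * r + 3) :=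
    f2_card_odd_of_split r g u hg hu hodd heven
  obtain ⟨k, rfl⟩ : ∃ k, r = k + 3 := ⟨r - 3, by omega⟩
  have hA : ∀ x, ¬ Odd (u x) → ¬ Odd (u x / 2) := by
    intro x hx h2
    have := filter_eq_empty_iff.1 (card_eq_zero.1 hA0) (mem_univ x)
    exact this ⟨hx, h2⟩
  have hB : ∀ x, ¬ Odd (u x) → ¬ Odd (u x / 2 / 2) := by
    intro x hx h3
    have := filter_eq_empty_iff.1 (card_eq_zero.1 hB0) (mem_univ x)
    exact this ⟨hx, hA x hx, h3⟩
  set C := univ.filter (fun x : Fin ((3 * (k + 3) + 2) + (3 * (k + 3) + 2)) → Bool =>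
    Odd (u x) ∧ ¬ (Odd (u x / 2) ↔ Odd (u x / 2 / 2))) with hCdef
  have hmemC : ∀ x, x ∈ C ↔ Odd (u x) ∧ ¬ (Odd (u x / 2) ↔ Odd (u x / 2 / 2)) := fun x => by simp [hCdef]
  have h4c : ∀ x, (4 : ℤ) ∣ 2 ^ (k + 3) * sZ (f x) := fun x => ⟨2 ^ (k + 1) * sZ (f x), by ring⟩
  -- the residual
  have hτH : ∀ x, ¬ Odd (u x) → u x - 2 ^ (k + 3) * sZ (f x) = 0 := by
    intro x hx
    have h := hpt x
    rw [if_neg hx, if_neg (fun h => hA x hx h.2), if_neg (fun h => hB x hx h.2.2), if_neg (fun h => hx h.1)] at h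
    have h' : (u x - 2 ^ (k + 3) * sZ (f x)) ^ 2 = 0 := by linarith
    exact (pow_eq_zero_iff two_ne_zero).1 h'
  have hτL : ∀ x, Odd (u x) → x ∉ C → u x - 2 ^ (k + 3) * sZ (f x) = sZ (decide (Odd (u x / 2))) := by
    intro x hx hxC
    have h := hpt x
    rw [if_pos hx, if_neg (fun h => h.1 hx), if_neg (fun h => h.1 hx), if_neg (fun h => hxC ((hmemC x).2 h))] at h
    have h1 : (u x - 2 ^ (k + 3) * sZ (f x)) * (u x - 2 ^ (k + 3) * sZ (f x)) = 1 := by rw [← pow_two]; linarith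
    exact z2_tau_one (h4c x) (mul_self_eq_one_iff.1 h1)
  have hτC : ∀ x, x ∈ C → u x - 2 ^ (k + 3) * sZ (f x) = -3 * sZ (decide (Odd (u x / 2))) := by
    intro x hxC
    have hx := ((hmemC x).1 hxC).1
    have h := hpt x
    rw [if_pos hx, if_neg (fun h => h.1 hx), if_neg (fun h => h.1 hx), if_pos ((hmemC x).1 hxC)] at h
    exact z2_tau_three (h4c x) (by linarith)
  -- `C` is an `(n−4)`-flat
  have hdegC : IsDegLeFun (3 + 1) (fun x => decide (Odd (u x / 2)) ^^ decide (Odd (u x / 2 / 2))) :=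
    bb_isDegLeFun_bxor (hd1.mono (by norm_num)) hd2
  have hsetC : (univ.filter fun x : Fin ((3 * (k + 3) + 2) + (3 * (k + 3) + 2)) → Bool =>
      (decide (Odd (u x / 2)) ^^ decide (Odd (u x / 2 / 2))) = true) = C := by
    rw [hCdef]
    apply filter_congr
    intro x _
    by_cases h0 : Odd (u x)
    · by_cases h1 : Odd (u x / 2) <;> by_cases h2 : Odd (u x / 2 / 2) <;> simp [h0, h1, h2]
    · simp [h0, hA x h0, hB x h0]
  have hmwC := mw_flat_of_minweight 3 _ hdegC (by rw [hsetC, hCc]; ring)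
  rw [hsetC] at hmwC
  obtain ⟨h0C, haddC, hcardVC, hcosetC⟩ := hmwC
  set VC := univ.filter (fun a : Fin ((3 * (k + 3) + 2) + (3 * (k + 3) + 2)) → Bool => ∀ x,
    (decide (Odd (u (bxor x a) / 2)) ^^ decide (Odd (u (bxor x a) / 2 / 2))) =
      (decide (Odd (u x / 2)) ^^ decide (Odd (u x / 2 / 2)))) with hVC
  have hCpos : 0 < #C := by rw [hCc]; exact Nat.two_pow_pos _
  obtain ⟨xC, hxC⟩ : C.Nonempty := card_pos.1 hCpos
  have hSC : C = VC.image (bxor xC) := hcosetC xC (z2_xor_decide_of_not_iff ((hmemC xC).1 hxC).2)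
  -- `L` : periods of `d₀`
  have hfiltL : (univ.filter fun x : Fin ((3 * (k + 3) + 2) + (3 * (k + 3) + 2)) → Bool => decide (Odd (u x)) = true) =
      univ.filter fun x => Odd (u x) := filter_congr fun x _ => by simp
  have hd0' : IsDegLeFun (0 + 1) (fun x => decide (Odd (u x))) := hd0
  have hmwL := mw_flat_of_minweight 0 _ hd0' (by rw [hfiltL, hLc]; ring)
  obtain ⟨h0L, haddL, hcardVL, -⟩ := hmwL
  rw [hfiltL, hLc] at hcardVL
  set VL := univ.filter (fun a : Fin ((3 * (k + 3) + 2) + (3 * (k + 3) + 2)) → Bool => ∀ x,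
    decide (Odd (u (bxor x a))) = decide (Odd (u x))) with hVL
  have hperL : ∀ a ∈ VL, ∀ x, decide (Odd (u (bxor x a))) = decide (Odd (u x)) := fun a ha => (mem_filter.1 ha).2
  -- `V_C ⊆ V_L`
  have hVCL : ∀ a ∈ VC, ∀ x, decide (Odd (u (bxor x a))) = decide (Odd (u x)) := by
    intro a ha x
    have hxa : bxor xC a ∈ C := fl1_coset_vadd haddC hSC hxC ha
    have hc := tc_const_of_deg_zero (stub_derivDegree ((3 * (k + 3) + 2) + (3 * (k + 3) + 2)) 0 (fun x => decide (Odd (u x))) a hd0)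
      x xC
    have e1 : decide (Odd (u xC)) = true := decide_eq_true ((hmemC xC).1 hxC).1
    have e2 : decide (Odd (u (bxor xC a))) = true := decide_eq_true ((hmemC _).1 hxa).1
    simp only [e1, e2] at hc
    revert hc; cases decide (Odd (u (bxor x a))) <;> cases decide (Odd (u x)) <;> decide
  -- `d₁ ≡ 0` on `H`
  have hqH : ∀ a : Fin ((3 * (k + 3) + 2) + (3 * (k + 3) + 2)) → Bool, (∀ x, decide (Odd (u (bxor x a))) = decide (Odd (u x))) →
      ∀ h, decide (Odd (u h)) = false → decide (Odd (u (bxor h a) / 2)) = decide (Odd (u h / 2)) := by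
    intro a ha h hh
    have hh' : ¬ Odd (u h) := by simpa using hh
    have hha : ¬ Odd (u (bxor h a)) := by have := ha h; rw [hh] at this; simpa using this
    rw [decide_eq_false (hA h hh'), decide_eq_false (hA _ hha)]
  obtain ⟨xH, hxH⟩ := heven
  have hxH' : decide (Odd (u xH)) = false := decide_eq_false hxH
  -- the two pieces of the residual
  set AL : (Fin ((3 * (k + 3) + 2) + (3 * (k + 3) + 2)) → Bool) → ℝ :=
    fun x => if decide (Odd (u x)) = true then signOf (decide (Odd (u x / 2))) else 0 with hAL
  set AC : (Fin ((3 * (k + 3) + 2) + (3 * (k + 3) + 2)) → Bool) → ℝ :=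
    fun x => if x ∈ C then signOf (decide (Odd (u x / 2))) else 0 with hAC
  have hdecomp : (fun x => (u x : ℝ) - (2 : ℝ) ^ (k + 3) * signOf (f x)) = fun x => AL x + (-4) * AC x := by
    funext x
    have e : (u x : ℝ) - (2 : ℝ) ^ (k + 3) * signOf (f x) = (((u x - 2 ^ (k + 3) * sZ (f x) : ℤ)) : ℝ) := by
      push_cast; rw [tp_sZ_cast]
    rw [e]
    by_cases hx : Odd (u x)
    · by_cases hxC' : x ∈ C
      · simp only [AL, AC, if_pos (decide_eq_true hx), if_pos hxC']
        rw [hτC x hxC']; push_cast; rw [tp_sZ_cast]; ring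
      · simp only [AL, AC, if_pos (decide_eq_true hx), if_neg hxC']
        rw [hτL x hx hxC']; rw [tp_sZ_cast]; ring
    · have hxC' : x ∉ C := fun h => hx ((hmemC x).1 h).1
      have hdx : ¬ decide (Odd (u x)) = true := by simpa using hx
      simp only [AL, AC, if_neg hdx, if_neg hxC']
      rw [hτH x hx]; norm_num
  have hN : (2 : ℝ) ^ ((3 * (k + 3) + 2) + (3 * (k + 3) + 2)) = 2 ^ (6 * k + 22) := by ring
  -- `L¹` bound for the `L`-piece
  have hL := sp_L_l1 (fun x => decide (Odd (u x))) (fun x => decide (Odd (u x / 2))) hd0 hd1 VL h0L haddL hperL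
    (fun a ha => hqH a (hperL a ha)) hxH'
  rw [hcardVL, hfiltL, hLc, hN] at hL
  have hXle : ∑ y, |W AL y| ≤ (2 : ℝ) ^ (6 * k + 22) := by
    have hnn : 0 ≤ ∑ y, |W AL y| := sum_nonneg fun y _ => abs_nonneg _
    have hposL : (0 : ℝ) < ((2 ^ (6 * (k + 3) + 3) : ℕ) : ℝ) := by positivity
    have h3 : (∑ y, |W AL y|) ^ 2 * ((2 ^ (6 * (k + 3) + 3) : ℕ) : ℝ) ≤ ((2 : ℝ) ^ (6 * k + 22)) ^ 2 * ((2 ^ (6 * (k + 3) + 3) : ℕ) : ℝ) :=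
      hL.trans_eq (by ring)
    exact (pow_le_pow_iff_left₀ hnn (by positivity) two_ne_zero).1 (le_of_mul_le_mul_right h3 hposL)
  -- `L¹` bound for the `C`-piece: periods up to sign along `V_C`
  have hperC : ∀ a ∈ VC, ∃ c : ℝ, (c = 1 ∨ c = -1) ∧ ∀ x, AC (bxor x a) = c * AC x := by
    intro a ha
    have hDq : IsDegLeFun 1 (fun y => decide (Odd (u y / 2)) ^^ decide (Odd (u (bxor y a) / 2))) :=
      stub_derivDegree ((3 * (k + 3) + 2) + (3 * (k + 3) + 2)) 1 (fun x => decide (Odd (u x / 2))) a hd1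
    have hDqH : ∀ h, decide (Odd (u h)) = false → (decide (Odd (u h / 2)) ^^ decide (Odd (u (bxor h a) / 2))) = false := by
      intro h hh; rw [hqH a (hVCL a ha) h hh]; cases decide (Odd (u h / 2)) <;> rfl
    refine ⟨signOf (decide (Odd (u xC / 2)) ^^ decide (Odd (u (bxor xC a) / 2))), ?_, fun x => ?_⟩
    · unfold signOf; split_ifs <;> simp
    · by_cases hx : x ∈ C
      · have hxa : bxor x a ∈ C := fl1_coset_vadd haddC hSC hx ha
        simp only [AC, if_pos hx, if_pos hxa]
        have hc := sp_affine_const_on_L _ (fun x => decide (Odd (u x))) hDq hd0 hDqH hxH'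
          (decide_eq_true ((hmemC x).1 hx).1) (decide_eq_true ((hmemC xC).1 hxC).1)
        have hqa : decide (Odd (u (bxor x a) / 2)) =
            (decide (Odd (u x / 2)) ^^ (decide (Odd (u xC / 2)) ^^ decide (Odd (u (bxor xC a) / 2)))) := by
          rw [← hc]; cases decide (Odd (u x / 2)) <;> cases decide (Odd (u (bxor x a) / 2)) <;> rfl
        rw [hqa, signOf_xor]; ring
      · have hxa : bxor x a ∉ C := fl1_coset_out' haddC hSC hx ha
        simp only [AC, if_neg hx, if_neg hxa, mul_zero]
  have hCb := fp_l1_sq_mul_le AC C VC (fun x hx => by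
      simp only [AC, if_pos hx]; unfold signOf; split_ifs <;> simp) (fun x hx => by simp only [AC, if_neg hx]) h0C haddC hperC
  rw [hcardVC, hCc, hN] at hCb
  have hYle : ∑ y, |W AC y| ≤ (2 : ℝ) ^ (6 * k + 22) := by
    have hnn : 0 ≤ ∑ y, |W AC y| := sum_nonneg fun y _ => abs_nonneg _
    have hposC : (0 : ℝ) < ((2 ^ (6 * (k + 3)) : ℕ) : ℝ) := by positivity
    have h3 : (∑ y, |W AC y|) ^ 2 * ((2 ^ (6 * (k + 3)) : ℕ) : ℝ) ≤ ((2 : ℝ) ^ (6 * k + 22)) ^ 2 * ((2 ^ (6 * (k + 3)) : ℕ) : ℝ) :=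
      hCb.trans_eq (by ring)
    exact (pow_le_pow_iff_left₀ hnn (by positivity) two_ne_zero).1 (le_of_mul_le_mul_right h3 hposC)
  -- pairing
  have hpair := fms_pairing (k + 3) f g u hu
  rw [hdecomp] at hpair
  have e2 : ∀ y, signOf (g y) * W (fun x => AL x + (-4) * AC x) y =
      signOf (g y) * W AL y + (-4) * (signOf (g y) * W AC y) := fun y => by
    rw [sp_W_add, fl1_W_smul]; ring
  rw [sum_congr rfl fun y _ => e2 y, sum_add_distrib, ← mul_sum,
    show (2 : ℝ) ^ (10 * (k + 3) + 6) = 2 ^ (2 * k + 7) * 2 ^ (8 * (k + 3) + 5) by ring, mul_assoc, hTeq] at hpair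
  have hPL : ∑ y, signOf (g y) * W AL y ≤ ∑ y, |W AL y| := fl1_pairing_le_l1 g (W AL)
  have hPC : |∑ y, signOf (g y) * W AC y| ≤ ∑ y, |W AC y| :=
    (abs_sum_le_sum_abs _ _).trans (sum_le_sum fun y _ => by
      rw [abs_mul]; unfold signOf; split_ifs <;> norm_num)
  have hPC' := (abs_le.1 hPC).1
  have hbig : (8 : ℝ) * 2 ^ (6 * k + 22) ≤ 2 ^ (2 * k + 7) * 2 ^ (6 * (k + 3) + 4) := by
    have e8 : (2 : ℝ) ^ (2 * k + 7) * 2 ^ (6 * (k + 3) + 4) = 2 ^ (2 * k + 4) * (8 * 2 ^ (6 * k + 22)) := by ring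
    rw [e8]
    have h1 : (1 : ℝ) ≤ 2 ^ (2 * k + 4) := one_le_pow₀ (by norm_num)
    have h2 : (0 : ℝ) ≤ 8 * 2 ^ (6 * k + 22) := by positivity
    exact le_mul_of_one_le_left h2 h1
  have hpos : (0 : ℝ) < 2 ^ (6 * k + 22) := by positivity
  linarith

end Summit.QuantumAdvantage.QuantumAdvantage.Theorems.CubicForrelation.NearExactIsExact

end
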